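import Literature.NumberTheory.LFunctions.DeuringPhenomenonElementary
import Literature.NumberTheory.LFunctions.ZetaOneLineBounds
import Literature.NumberTheory.LFunctions.DirichletLOneTail
import Literature.NumberTheory.Sieve.PolyaVinogradovNonprincipal
import Mathlib.NumberTheory.ArithmeticFunction.Misc
import HarnessLib

/-!
# Pintz 1976 (III), Lemma 4 — PROVED (the repaired named fact `pintz1976Deuring_lemma4_largeD`)

Topic `Literature/NumberTheory/LFunctions` (namespace `Literature.NumberTheory.LFunctions`, helpers in
the grouping sub-namespace `Pintz1976Deuring`). PROOF LAYER for the statement file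
`DeuringPhenomenonElementary.lean` (cell `parity-realchar`, SIEGEL INSTRUMENT / Deuring direction):
the named fact

* `pintz1976Deuring_lemma4_largeD` — J. Pintz, *Elementary methods in the theory of L-functions, III.
  The Deuring-phenomenon*, Acta Arith. **31** (1976) 295–306, Lemma 4 p. 298 (3.1)–(3.2) under the
  paper's standing assumption "`D > D₁`" (p. 296): for every non-principal `χ` mod `D > D₁`,
  `s = 1 − τ + it ≠ 1`, `0 ≤ τ ≤ ½`, `A_s = max(1, 1/|1−s|)`, `x ≥ |s|²A_s√D`,
  `Σ_{n≤x} g(n) n^{−s} = L(s)ζ(s) + L(1)x^{1−s}/(1−s) + O(x^τ|s|D^{1/4}√A_s log D log x/√x)`,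
  `g = 1 ∗ χ`, absolute constants —

is discharged here as `theorem pintz1976Deuring_lemma4_largeD_holds : pintz1976Deuring_lemma4_largeD`
with `C = 2000`, `D₁ = 200`. Everything in this file is PROVED (theorems only; no definition, no named
fact); axioms `propext`, `Classical.choice`, `Quot.sound`. (The first typed rendering
`pintz1976Deuring_lemma4`, without `D > D₁`, is false — `pintz1976Deuring_lemma4_false` in the
statement file.)

## Source and road (printed proof pp. 298–300, READ from the journal scan `paper:url-dc41f4bea12a`)

PRINT: "(3.3) `Σ_{n≤x} g(n)/n^s = Σ_{d≤x} χ(d)/d^s Σ_{m≤x/d} 1/m^s = Σ₁ + Σ₂` [`d ≤ z` / `z < d ≤ x`].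
Using that for `s ≠ 1−τ+it`, `0 ≤ τ ≤ ½`, `Σ_{m≤M} m^{−s} = ζ(s) + M^{1−s}/(1−s) + O(|s|/M^{1−τ})` (where
the constant in `O` symbol is absolute), we get (3.4) `Σ₁ = (Σ_{d≤z} χ(d)d^{−s})ζ(s) +
x^{1−s}/(1−s)·Σ_{d≤z} χ(d)/d + O(|s| z x^τ/x)`. Using the Pólya–Vinogradov inequality
`|Σ_a^b χ(d)| ≪ √D log D`, by partial summation (3.5) `Σ_{d>z} χ(d)d^{−s} = O(|s|√D log D z^τ/z)`,
(3.6) `Σ_{d>z} χ(d)/d = O(√D log D/z)` and (3.7) `Σ₂ = O(|s|√D log D x^τ log x/z)`. So (3.8) … We shall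
use that (3.9) `|ζ(s)| ≪ |s|^τ log(|s|+1) A_s`. So if we choose `z = √x·D^{1/4}·√A_s (≤ x)` then as
`|s|z ≤ x`, `log(|s|+1) < log x`, … all the error terms have the required order
`O(|s| log D log x·x^τ D^{1/4}√A_s/√x)`. ∎"

HERE, in the same order, with the tree's engines:

* **Section A — (3.3) and the swap in (3.7)** (`sum_Ioc_divisorSum_mul_cpow_eq`,
  `sum_Ioc_above_mul_sum_eq`): Mathlib's `ArithmeticFunction.sum_Ioc_mul_eq_sum_sum` for the
  arithmetic functions `d ↦ χ(d)d^{−s}·[d > y]` and `m ↦ m^{−s}`.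
* **Section B — the first display of p. 299** (`sum_Icc_cpow_eq`, `norm_sum_floor_cpow_sub_le`):
  `Σ_{m≤M} m^{−s} = ζ(s) + M^{1−s}/(1−s) + s∫_M^∞{u}u^{−s−1}du` from the tree's
  `ZetaOneLine.riemannZeta_eq_sum_add_sub_integral` (Titchmarsh (3.5.3)), tail `≤ |s|M^{−σ}/σ`
  (`ZetaOneLine.norm_integral_Ioi_fract_mul_cpow_le`), and the passage to real `M`
  (`‖y^{1−s} − ⌊y⌋^{1−s}‖ ≤ |1−s|⌊y⌋^{−σ}`, mean value theorem), giving the remainder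
  `(|s|/σ + 1)⌊y⌋^{−σ}`.
* **Section C — (3.5)/(3.6) by partial summation** (`norm_sum_char_cpow_sub_LFunction_le`,
  `norm_sum_Ioc_char_cpow_le`): with `‖S(n)‖ ≤ B` for the partial sums of `χ`, the tree's Abel
  representation `DirichletAbel.LFunction_eq_abelSum` (`L(s,χ) = Σ S(n)(n^{−s} − (n+1)^{−s})`,
  `Re s > 0`) gives `‖Σ_{n≤N} χ(n)n^{−s} − L(s,χ)‖ ≤ B(1 + |s|/σ)N^{−σ}` (telescoping
  `σ(n+1)^{−σ−1} ≤ n^{−σ} − (n+1)^{−σ}`), hence finite blocks `≤ 2B(1 + |s|/σ)y^{−σ}`.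
* **Section D — (3.9)** (`norm_riemannZeta_le_floor`): from Section B at `M = ⌊|s|⌋ + 1`,
  `‖ζ(s)‖ ≤ M^{1−σ}(1 + log M + 1/|1−s| + 1/σ)`; and `Σ_{m≤K} m^{−σ} ≤ K^{1−σ}(1 + log K)`.
* **Section E — (3.3)–(3.8) as one exact identity** (`lemma4_decomposition`): with `N = ⌊x⌋`,
  `Σ_{n≤N} g(n)n^{−s} − L(s)ζ(s) − L(1)x^{1−s}/(1−s) = ζ(s)(V_s − L(s)) + (x^{1−s}/(1−s))(V_1 − L(1))
  + Σ_{d≤z} χ(d)d^{−s}R_d + Σ_{m≤N} m^{−s} Σ_{z<d≤N/m} χ(d)d^{−s}` (`V_w = Σ_{d≤z}χ(d)d^{−w}`,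
  `R_d` the Section-B remainder at `x/d`; `d^{−s}(x/d)^{1−s} = x^{1−s}d^{−1}`).
* **Section F — the sizes of the four pieces** (`norm_third_piece_le`, `norm_fourth_piece_le`).
* **Section G — Pólya–Vinogradov and the choice of `z`** (`norm_partialSum_le_pv` = the tree's
  `LargeSieve.polyaVinogradov_of_ne_one_Icc`, valid for EVERY non-principal `χ`, `≤ 9√D log D`;
  `lemma4_real_final` = the bookkeeping of p. 300 with `z = min(⌊x⌋, ⌊√x D^{1/4}√A_s⌋)` — the
  print's "`z ≤ x`" needs `|s| ≥ 1`, so the case `⌊x⌋ < z` (then `Σ₂` is harmless) is carried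
  separately; `D₁ = 200` makes `x ≥ |s|²A_s√D ≥ √D/4 > e`, so `log x, log D ≥ 1`).

## References

* [Pintz1976ElementaryIII] J. Pintz, Acta Arith. 31 (1976) 295–306: Lemma 4 p. 298 (3.1)–(3.2),
  proof pp. 298–300 (3.3)–(3.9); standing assumption "`D > D₁`" p. 296.
* [MontgomeryVaughan2007] H. L. Montgomery, R. C. Vaughan, *Multiplicative Number Theory I*, CUP
  2007: §1.3 Thm. 1.3 (Abel summation), §9.4 Thm. 9.18 (Pólya–Vinogradov).
* [Titchmarsh1986] E. C. Titchmarsh, *The Theory of the Riemann Zeta-Function*, 2nd ed., §3.5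
  (3.5.3) (partial sums of `ζ`).
-/

noncomputable section

open Complex Finset ArithmeticFunction

namespace Literature.NumberTheory.LFunctions

namespace Pintz1976Deuring

variable {q : ℕ} (χ : DirichletCharacter ℂ q)

/-! ### Section A — hyperbola identities -/

/-- A sum over `0 < a ≤ M` of a function vanishing for `a ≤ y` is a sum over `y < a ≤ M`. [folklore] -/
private theorem sum_Ioc_ite_lt (f : ℕ → ℂ) (y M : ℕ) :
    ∑ a ∈ Ioc 0 M, (if y < a then f a else 0) = ∑ a ∈ Ioc y M, f a := by
  rw [← sum_filter]
  congr 1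
  ext a
  simp only [mem_filter, mem_Ioc]
  omega

/-- **(3.3), Dirichlet's hyperbola identity for `Σ g(n) n^{-s}`**:
`Σ_{n ≤ N} g(n) n^{-s} = Σ_{d ≤ N} χ(d) d^{-s} Σ_{m ≤ N/d} m^{-s}` (`g = 1 ∗ χ`).
[cite: Pintz1976ElementaryIII, Lemma 4 proof (3.3) p. 298] -/
theorem sum_Ioc_divisorSum_mul_cpow_eq (s : ℂ) (N : ℕ) :
    ∑ n ∈ Ioc 0 N, (∑ d ∈ n.divisors, χ d) * (n : ℂ) ^ (-s) =
      ∑ d ∈ Ioc 0 N, χ d * (d : ℂ) ^ (-s) * ∑ m ∈ Ioc 0 (N / d), (m : ℂ) ^ (-s) := by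
  -- the arithmetic functions `F(d) = χ(d) d^{-s}` and `G(m) = m^{-s}` (both `0` at `0`)
  set F : ArithmeticFunction ℂ := ⟨fun d => if 0 < d then χ d * (d : ℂ) ^ (-s) else 0, by simp⟩
    with hF
  set G : ArithmeticFunction ℂ := ⟨fun m => if m = 0 then 0 else (m : ℂ) ^ (-s), by simp⟩ with hG
  have hFapp : ∀ d : ℕ, F d = if 0 < d then χ d * (d : ℂ) ^ (-s) else 0 := fun d => rfl
  have hGapp : ∀ {m : ℕ}, m ≠ 0 → G m = (m : ℂ) ^ (-s) := fun {m} hm => by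
    show (if m = 0 then 0 else (m : ℂ) ^ (-s)) = _
    rw [if_neg hm]
  -- `(F * G)(n) = g(n) n^{-s}`
  have hFG : ∀ n : ℕ, (F * G) n = (∑ d ∈ n.divisors, χ d) * (n : ℂ) ^ (-s) := by
    intro n
    rcases eq_or_ne n 0 with rfl | hn
    · simp
    rw [mul_apply, ← Nat.map_div_right_divisors, Finset.sum_map, Finset.sum_mul]
    refine sum_congr rfl fun d hd => ?_
    have hdn : d ∣ n := Nat.dvd_of_mem_divisors hd
    have hd0 : d ≠ 0 := ne_zero_of_dvd_ne_zero hn hdn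
    have hnd0 : n / d ≠ 0 := (Nat.div_ne_zero_iff_of_dvd hdn).mpr ⟨hn, hd0⟩
    simp only [Function.Embedding.coeFn_mk, hFapp, Nat.pos_of_ne_zero hd0, if_true, hGapp hnd0]
    rw [mul_assoc, ← natCast_mul_natCast_cpow, ← Nat.cast_mul, Nat.mul_div_cancel' hdn]
  have h := sum_Ioc_mul_eq_sum_sum F G N
  simp_rw [hFG] at h
  rw [h]
  refine sum_congr rfl fun d hd => ?_
  have hd0 : 0 < d := (mem_Ioc.mp hd).1
  rw [hFapp, if_pos hd0]
  congr 1
  exact sum_congr rfl fun m hm => hGapp (mem_Ioc.mp hm).1.ne'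

/-- **The swap used in (3.7)**: `Σ_{y < d ≤ N} χ(d) d^{-s} Σ_{m ≤ N/d} m^{-s} =
Σ_{m ≤ N} m^{-s} Σ_{y < d ≤ N/m} χ(d) d^{-s}` (both count `χ(d)(dm)^{-s}` over `dm ≤ N`, `d > y`).
[cite: Pintz1976ElementaryIII, Lemma 4 proof (3.7) p. 299] -/
theorem sum_Ioc_above_mul_sum_eq (s : ℂ) (y N : ℕ) :
    ∑ d ∈ Ioc y N, χ d * (d : ℂ) ^ (-s) * ∑ m ∈ Ioc 0 (N / d), (m : ℂ) ^ (-s) =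
      ∑ m ∈ Ioc 0 N, (m : ℂ) ^ (-s) * ∑ d ∈ Ioc y (N / m), χ d * (d : ℂ) ^ (-s) := by
  set F : ArithmeticFunction ℂ := ⟨fun d => if y < d then χ d * (d : ℂ) ^ (-s) else 0, by simp⟩
    with hF
  set G : ArithmeticFunction ℂ := ⟨fun m => if m = 0 then 0 else (m : ℂ) ^ (-s), by simp⟩ with hG
  have hFapp : ∀ d : ℕ, F d = if y < d then χ d * (d : ℂ) ^ (-s) else 0 := fun d => rfl
  have hGapp : ∀ {m : ℕ}, m ≠ 0 → G m = (m : ℂ) ^ (-s) := fun {m} hm => by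
    show (if m = 0 then 0 else (m : ℂ) ^ (-s)) = _
    rw [if_neg hm]
  have h1 := sum_Ioc_mul_eq_sum_sum F G N
  have h2 := sum_Ioc_mul_eq_sum_sum G F N
  rw [mul_comm, h1] at h2
  have e1 : ∑ d ∈ Ioc 0 N, F d * ∑ m ∈ Ioc 0 (N / d), G m =
      ∑ d ∈ Ioc y N, χ d * (d : ℂ) ^ (-s) * ∑ m ∈ Ioc 0 (N / d), (m : ℂ) ^ (-s) := by
    rw [← sum_Ioc_ite_lt (fun d => χ d * (d : ℂ) ^ (-s) * ∑ m ∈ Ioc 0 (N / d), (m : ℂ) ^ (-s))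
      y N]
    refine sum_congr rfl fun d hd => ?_
    rw [hFapp]
    split_ifs with h
    · congr 1
      exact sum_congr rfl fun m hm => hGapp (mem_Ioc.mp hm).1.ne'
    · rw [zero_mul]
  have e2 : ∑ m ∈ Ioc 0 N, G m * ∑ d ∈ Ioc 0 (N / m), F d =
      ∑ m ∈ Ioc 0 N, (m : ℂ) ^ (-s) * ∑ d ∈ Ioc y (N / m), χ d * (d : ℂ) ^ (-s) := by
    refine sum_congr rfl fun m hm => ?_
    rw [hGapp (mem_Ioc.mp hm).1.ne']
    congr 1
    simp_rw [hFapp]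
    exact sum_Ioc_ite_lt _ y (N / m)
  rw [← e1, h2, e2]

/-! ### Section B — partial sums of `ζ` -/

/-- **`Σ_{m ≤ M} m^{-s} = ζ(s) + M^{1-s}/(1-s) + s∫_M^∞ {x} x^{-s-1} dx`** for natural `M ≥ 1`,
`Re s > 0`, `s ≠ 1` (the tree's `ZetaOneLine.riemannZeta_eq_sum_add_sub_integral` solved for the sum).
[cite: Pintz1976ElementaryIII, Lemma 4 proof p. 299 (first display)] -/
theorem sum_Icc_cpow_eq {s : ℂ} (hs : 0 < s.re) (hs1 : s ≠ 1) {M : ℕ} (hM : 1 ≤ M) :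
    ∑ m ∈ Icc 1 M, (m : ℂ) ^ (-s) = riemannZeta s + (M : ℂ) ^ (1 - s) / (1 - s) +
      s * ∫ x in Set.Ioi (M : ℝ), ((Int.fract x : ℝ) : ℂ) * (x : ℂ) ^ (-(s + 1)) := by
  rw [ZetaOneLine.riemannZeta_eq_sum_add_sub_integral hs hs1 hM]
  have h1 : (1 - s) ≠ 0 := sub_ne_zero.mpr (Ne.symm hs1)
  have h2 : (s - 1) ≠ 0 := sub_ne_zero.mpr hs1
  have : (M : ℂ) ^ (1 - s) / (s - 1) = -((M : ℂ) ^ (1 - s) / (1 - s)) := by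
    rw [← neg_sub 1 s, div_neg]
  rw [this]
  ring

/-- The remainder bound `‖s∫_M^∞ {x} x^{-s-1} dx‖ ≤ ‖s‖ M^{-σ}/σ` (`M ≥ 1`, `σ = Re s > 0`).
[cite: Pintz1976ElementaryIII, Lemma 4 proof p. 299 (first display)] -/
theorem norm_mul_integral_fract_le {s : ℂ} (hs : 0 < s.re) {M : ℕ} (hM : 1 ≤ M) :
    ‖s * ∫ x in Set.Ioi (M : ℝ), ((Int.fract x : ℝ) : ℂ) * (x : ℂ) ^ (-(s + 1))‖ ≤
      ‖s‖ * ((M : ℝ) ^ (-s.re) / s.re) := by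
  rw [norm_mul]
  exact mul_le_mul_of_nonneg_left
    (ZetaOneLine.norm_integral_Ioi_fract_mul_cpow_le hs (by exact_mod_cast hM)) (norm_nonneg _)

/-- `‖y^{1-s} − ⌊y⌋^{1-s}‖ ≤ ‖1 − s‖ ⌊y⌋^{-σ}` for real `y ≥ 1`, `0 ≤ σ = Re s` (mean value theorem on
`[⌊y⌋, y]`, an interval of length `< 1`). [folklore] -/
private theorem norm_cpow_sub_floor_cpow_le {s : ℂ} (hσ : 0 ≤ s.re) {y : ℝ} (hy : 1 ≤ y) :
    ‖(y : ℂ) ^ (1 - s) - ((⌊y⌋₊ : ℕ) : ℂ) ^ (1 - s)‖ ≤ ‖1 - s‖ * ((⌊y⌋₊ : ℕ) : ℝ) ^ (-s.re) := by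
  set N : ℕ := ⌊y⌋₊ with hN
  have hN1 : 1 ≤ N := Nat.le_floor (by exact_mod_cast hy)
  have hN0 : (0 : ℝ) < N := by exact_mod_cast hN1
  have hNy : (N : ℝ) ≤ y := Nat.floor_le (by linarith)
  have hyN : y - N ≤ 1 := by
    have := Nat.lt_floor_add_one y
    rw [← hN] at this
    linarith
  rcases eq_or_ne (1 - s) 0 with h1s | h1s
  · simp [h1s]
  have key := norm_image_sub_le_of_norm_deriv_le_segment' (f := fun t : ℝ => (t : ℂ) ^ (1 - s))
    (f' := fun t : ℝ => (1 - s) * (t : ℂ) ^ (1 - s - 1)) (a := (N : ℝ)) (b := y)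
    (C := ‖1 - s‖ * (N : ℝ) ^ (-s.re)) ?_ ?_ y ⟨hNy, le_rfl⟩
  · have e2 : ((N : ℕ) : ℂ) = ((N : ℝ) : ℂ) := by push_cast; ring
    rw [e2]
    calc ‖(y : ℂ) ^ (1 - s) - ((N : ℝ) : ℂ) ^ (1 - s)‖ ≤ ‖1 - s‖ * (N : ℝ) ^ (-s.re) * (y - N) := by
          simpa using key
      _ ≤ ‖1 - s‖ * (N : ℝ) ^ (-s.re) * 1 := by gcongr
      _ = ‖1 - s‖ * (N : ℝ) ^ (-s.re) := mul_one _
  · intro x hx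
    have hx0 : x ≠ 0 := by linarith [hx.1]
    exact (hasDerivAt_ofReal_cpow_const hx0 h1s).hasDerivWithinAt
  · intro x hx
    have hx0 : 0 < x := by linarith [hx.1]
    rw [norm_mul, Complex.norm_cpow_eq_rpow_re_of_pos hx0]
    gcongr
    have : (1 - s - 1).re = -s.re := by simp
    rw [this]
    exact Real.rpow_le_rpow_of_nonpos hN0 hx.1 (by linarith)

/-- **Real-`M` form of the first display on p. 299**: for real `y ≥ 1`, `0 < σ = Re s ≤ 1`, `s ≠ 1`,
`‖Σ_{m ≤ y} m^{-s} − ζ(s) − y^{1-s}/(1-s)‖ ≤ (‖s‖/σ + 1)·⌊y⌋^{-σ}`.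
[cite: Pintz1976ElementaryIII, Lemma 4 proof p. 299 (first display)] -/
theorem norm_sum_floor_cpow_sub_le {s : ℂ} (hs : 0 < s.re) (hs1 : s ≠ 1) {y : ℝ} (hy : 1 ≤ y) :
    ‖(∑ m ∈ Icc 1 ⌊y⌋₊, (m : ℂ) ^ (-s)) - riemannZeta s - (y : ℂ) ^ (1 - s) / (1 - s)‖ ≤
      (‖s‖ / s.re + 1) * ((⌊y⌋₊ : ℕ) : ℝ) ^ (-s.re) := by
  have hN1 : 1 ≤ ⌊y⌋₊ := Nat.le_floor (by exact_mod_cast hy)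
  have h1s : (1 - s) ≠ 0 := sub_ne_zero.mpr (Ne.symm hs1)
  rw [sum_Icc_cpow_eq hs hs1 hN1]
  have hsplit : riemannZeta s + ((⌊y⌋₊ : ℕ) : ℂ) ^ (1 - s) / (1 - s) +
        s * (∫ x in Set.Ioi ((⌊y⌋₊ : ℕ) : ℝ), ((Int.fract x : ℝ) : ℂ) * (x : ℂ) ^ (-(s + 1))) -
        riemannZeta s - (y : ℂ) ^ (1 - s) / (1 - s) =
      s * (∫ x in Set.Ioi ((⌊y⌋₊ : ℕ) : ℝ), ((Int.fract x : ℝ) : ℂ) * (x : ℂ) ^ (-(s + 1))) -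
        ((y : ℂ) ^ (1 - s) - ((⌊y⌋₊ : ℕ) : ℂ) ^ (1 - s)) / (1 - s) := by ring
  rw [hsplit]
  refine (norm_sub_le _ _).trans ?_
  rw [add_mul]
  refine add_le_add ?_ ?_
  · refine (norm_mul_integral_fract_le hs hN1).trans (le_of_eq ?_)
    ring
  · rw [norm_div, div_le_iff₀ (norm_pos_iff.mpr h1s), one_mul]
    calc ‖(y : ℂ) ^ (1 - s) - ((⌊y⌋₊ : ℕ) : ℂ) ^ (1 - s)‖
        ≤ ‖1 - s‖ * ((⌊y⌋₊ : ℕ) : ℝ) ^ (-s.re) := norm_cpow_sub_floor_cpow_le hs.le hy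
      _ = ((⌊y⌋₊ : ℕ) : ℝ) ^ (-s.re) * ‖1 - s‖ := mul_comm _ _


/-! ### Section C — Dirichlet polynomials of `χ` by Abel summation ((3.5)–(3.6)) -/

open Literature.NumberTheory.LFunctions.DirichletAbel

/-- Mean value theorem: `σ (a+1)^{-σ-1} ≤ a^{-σ} − (a+1)^{-σ}` for `a > 0`, `σ > 0`. [folklore] -/
private theorem mul_rpow_neg_succ_le_sub {σ : ℝ} (hσ : 0 < σ) {a : ℝ} (ha : 0 < a) :
    σ * (a + 1) ^ (-σ - 1) ≤ a ^ (-σ) - (a + 1) ^ (-σ) := by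
  have hderiv : ∀ u ∈ Set.Ioo a (a + 1),
      HasDerivAt (fun u : ℝ => u ^ (-σ)) (-σ * u ^ (-σ - 1)) u := by
    intro u hu
    have hu0 : u ≠ 0 := (ha.trans hu.1).ne'
    simpa using Real.hasDerivAt_rpow_const (p := -σ) (Or.inl hu0)
  have hcont : ContinuousOn (fun u : ℝ => u ^ (-σ)) (Set.Icc a (a + 1)) := by
    refine continuousOn_of_forall_continuousAt fun u hu => ?_
    exact (Real.continuousAt_rpow_const _ _ (Or.inl (ha.trans_le hu.1).ne'))
  obtain ⟨ξ, hξ, hξ'⟩ := exists_hasDerivAt_eq_slope (fun u : ℝ => u ^ (-σ))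
    (fun u => -σ * u ^ (-σ - 1)) (by linarith) hcont hderiv
  have hξ0 : 0 < ξ := ha.trans hξ.1
  have hslope : (a + 1) ^ (-σ) - a ^ (-σ) = -σ * ξ ^ (-σ - 1) := by
    rw [hξ']; field_simp; ring
  have hmono : (a + 1) ^ (-σ - 1) ≤ ξ ^ (-σ - 1) :=
    Real.rpow_le_rpow_of_nonpos hξ0 hξ.2.le (by linarith)
  nlinarith

/-- Telescoping: `∑_{n ≥ 0} ((n+N)^{-σ} − (n+N+1)^{-σ}) = N^{-σ}` for `N ≥ 1`, `σ > 0`. [folklore] -/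
private theorem hasSum_rpow_neg_telescope {σ : ℝ} (hσ : 0 < σ) {N : ℕ} (hN : 1 ≤ N) :
    HasSum (fun n : ℕ => ((n + N : ℕ) : ℝ) ^ (-σ) - (((n + N : ℕ) : ℝ) + 1) ^ (-σ))
      ((N : ℝ) ^ (-σ)) := by
  have hnn : ∀ n : ℕ, 0 ≤ ((n + N : ℕ) : ℝ) ^ (-σ) - (((n + N : ℕ) : ℝ) + 1) ^ (-σ) := by
    intro n
    have h0 : (0 : ℝ) < ((n + N : ℕ) : ℝ) := by positivity
    have := mul_rpow_neg_succ_le_sub hσ h0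
    nlinarith [Real.rpow_nonneg (by positivity : (0 : ℝ) ≤ ((n + N : ℕ) : ℝ) + 1) (-σ - 1)]
  refine (hasSum_iff_tendsto_nat_of_nonneg hnn _).mpr ?_
  have htel : ∀ M : ℕ, ∑ n ∈ range M, (((n + N : ℕ) : ℝ) ^ (-σ) - (((n + N : ℕ) : ℝ) + 1) ^ (-σ)) =
      (N : ℝ) ^ (-σ) - ((M : ℝ) + N) ^ (-σ) := by
    intro M
    induction M with
    | zero => simp
    | succ M ih =>
      rw [sum_range_succ, ih]
      push_cast
      ring_nf
  simp_rw [htel]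
  have h1 : Filter.Tendsto (fun M : ℕ => (M : ℝ) + N) Filter.atTop Filter.atTop :=
    Filter.tendsto_atTop_add_const_right _ _ tendsto_natCast_atTop_atTop
  have h2 : Filter.Tendsto (fun M : ℕ => ((M : ℝ) + N) ^ (-σ)) Filter.atTop (nhds 0) :=
    (tendsto_rpow_neg_atTop hσ).comp h1
  simpa using (tendsto_const_nhds (x := (N : ℝ) ^ (-σ))).sub h2

/-- Tail of the Abel series: `‖∑_{n ≥ N} S(n+1)((n+1)^{-s} − (n+2)^{-s})‖ ≤ (B‖s‖/σ) N^{-σ}` when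
`‖S(n)‖ ≤ B` for all `n` (`N ≥ 1`, `σ = Re s > 0`). [cite: MontgomeryVaughan2007, §1.3 Thm. 1.3] -/
theorem norm_tsum_term_add_le {B : ℝ} (hB : ∀ n, ‖partialSum χ n‖ ≤ B) {s : ℂ} (hs : 0 < s.re)
    {N : ℕ} (hN : 1 ≤ N) :
    ‖∑' n : ℕ, term χ (n + N) s‖ ≤ B * ‖s‖ / s.re * (N : ℝ) ^ (-s.re) := by
  have hB0 : 0 ≤ B := (norm_nonneg _).trans (hB 0)
  refine tsum_of_norm_bounded ((hasSum_rpow_neg_telescope hs hN).mul_left (B * ‖s‖ / s.re))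
    fun n => ?_
  refine (norm_term_le' χ (n + N) hs).trans ?_
  have h0 : (0 : ℝ) < ((n + N : ℕ) : ℝ) := by
    have : 1 ≤ n + N := by omega
    exact_mod_cast this
  have hmvt := mul_rpow_neg_succ_le_sub hs h0
  have e : ((n + N + 1 : ℕ) : ℝ) = ((n + N : ℕ) : ℝ) + 1 := by push_cast; ring
  rw [e]
  calc ‖partialSum χ (n + N + 1)‖ * (‖s‖ * ((((n + N : ℕ) : ℝ) + 1) ^ (-s.re - 1)))
      ≤ B * (‖s‖ * ((((n + N : ℕ) : ℝ) + 1) ^ (-s.re - 1))) :=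
        mul_le_mul_of_nonneg_right (hB _) (by positivity)
    _ = B * ‖s‖ / s.re * (s.re * (((n + N : ℕ) : ℝ) + 1) ^ (-s.re - 1)) := by
        field_simp
    _ ≤ B * ‖s‖ / s.re * (((n + N : ℕ) : ℝ) ^ (-s.re) - (((n + N : ℕ) : ℝ) + 1) ^ (-s.re)) :=
        mul_le_mul_of_nonneg_left hmvt (by positivity)

/-- `∑_{1 ≤ n ≤ N} f(n) = ∑_{n < N} f(n+1)`. [folklore] -/
private theorem sum_Ioc_eq_sum_range (f : ℕ → ℂ) (N : ℕ) :
    ∑ n ∈ Ioc 0 N, f n = ∑ n ∈ range N, f (n + 1) := by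
  induction N with
  | zero => simp
  | succ N ih => rw [Finset.sum_Ioc_succ_top (Nat.zero_le _), ih, sum_range_succ]

variable [NeZero q]

/-- **(3.5)-type tail**: if `‖S(n)‖ ≤ B` for all `n` (`S(n) = Σ_{k ≤ n} χ(k)`), then for `N ≥ 1` and
`σ = Re s > 0`, `‖Σ_{n ≤ N} χ(n) n^{-s} − L(s, χ)‖ ≤ B (1 + ‖s‖/σ) N^{-σ}`.
[cite: Pintz1976ElementaryIII, Lemma 4 proof (3.5)–(3.6) p. 299] -/
theorem norm_sum_char_cpow_sub_LFunction_le (hχ : χ ≠ 1) {B : ℝ} (hB : ∀ n, ‖partialSum χ n‖ ≤ B)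
    {s : ℂ} (hs : 0 < s.re) {N : ℕ} (hN : 1 ≤ N) :
    ‖(∑ n ∈ Ioc 0 N, χ n * (n : ℂ) ^ (-s)) - χ.LFunction s‖ ≤
      B * (1 + ‖s‖ / s.re) * (N : ℝ) ^ (-s.re) := by
  have hB0 : 0 ≤ B := (norm_nonneg _).trans (hB 0)
  have hN0 : (0 : ℝ) < N := by exact_mod_cast hN
  have hsum := summable_term χ hχ hs
  have hL : χ.LFunction s = (∑ n ∈ range N, term χ n s) + ∑' n : ℕ, term χ (n + N) s := by
    rw [LFunction_eq_abelSum χ hχ hs, abelSum]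
    exact (hsum.sum_add_tsum_nat_add N).symm
  have hS : ∑ n ∈ Ioc 0 N, χ n * (n : ℂ) ^ (-s) =
      partialSum χ N * ((N + 1 : ℕ) : ℂ) ^ (-s) + ∑ n ∈ range N, term χ n s := by
    rw [← sum_apply_mul_cpow_eq χ s N, sum_Ioc_eq_sum_range]
  rw [hL, hS]
  have e : partialSum χ N * ((N + 1 : ℕ) : ℂ) ^ (-s) + ∑ n ∈ range N, term χ n s -
      (∑ n ∈ range N, term χ n s + ∑' n : ℕ, term χ (n + N) s) =
      partialSum χ N * ((N + 1 : ℕ) : ℂ) ^ (-s) - ∑' n : ℕ, term χ (n + N) s := by ring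
  rw [e]
  refine (norm_sub_le _ _).trans ?_
  have h1 : ‖partialSum χ N * ((N + 1 : ℕ) : ℂ) ^ (-s)‖ ≤ B * (N : ℝ) ^ (-s.re) := by
    rw [norm_mul, norm_natCast_cpow_of_pos (Nat.succ_pos N), neg_re]
    refine mul_le_mul (hB N) ?_ (by positivity) hB0
    exact Real.rpow_le_rpow_of_nonpos hN0 (by push_cast; linarith) (by linarith [hs])
  have h2 := norm_tsum_term_add_le χ hB hs hN
  calc ‖partialSum χ N * ((N + 1 : ℕ) : ℂ) ^ (-s)‖ + ‖∑' n : ℕ, term χ (n + N) s‖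
      ≤ B * (N : ℝ) ^ (-s.re) + B * ‖s‖ / s.re * (N : ℝ) ^ (-s.re) := add_le_add h1 h2
    _ = B * (1 + ‖s‖ / s.re) * (N : ℝ) ^ (-s.re) := by ring

/-- **Finite blocks**: under the same hypotheses, for `1 ≤ y ≤ Y`,
`‖Σ_{y < n ≤ Y} χ(n) n^{-s}‖ ≤ 2B(1 + ‖s‖/σ) y^{-σ}`.
[cite: Pintz1976ElementaryIII, Lemma 4 proof (3.5) p. 299] -/
theorem norm_sum_Ioc_char_cpow_le (hχ : χ ≠ 1) {B : ℝ} (hB : ∀ n, ‖partialSum χ n‖ ≤ B)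
    {s : ℂ} (hs : 0 < s.re) {y Y : ℕ} (hy : 1 ≤ y) (hyY : y ≤ Y) :
    ‖∑ n ∈ Ioc y Y, χ n * (n : ℂ) ^ (-s)‖ ≤ 2 * B * (1 + ‖s‖ / s.re) * (y : ℝ) ^ (-s.re) := by
  have hB0 : 0 ≤ B := (norm_nonneg _).trans (hB 0)
  have hy0 : (0 : ℝ) < y := by exact_mod_cast hy
  have hsplit : ∑ n ∈ Ioc y Y, χ n * (n : ℂ) ^ (-s) =
      ((∑ n ∈ Ioc 0 Y, χ n * (n : ℂ) ^ (-s)) - χ.LFunction s) -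
        ((∑ n ∈ Ioc 0 y, χ n * (n : ℂ) ^ (-s)) - χ.LFunction s) := by
    rw [← Finset.sum_Ioc_consecutive _ (Nat.zero_le y) hyY]
    ring
  rw [hsplit]
  refine (norm_sub_le _ _).trans ?_
  have hY := norm_sum_char_cpow_sub_LFunction_le χ hχ hB hs (hy.trans hyY)
  have hy' := norm_sum_char_cpow_sub_LFunction_le χ hχ hB hs hy
  have hmono : (Y : ℝ) ^ (-s.re) ≤ (y : ℝ) ^ (-s.re) :=
    Real.rpow_le_rpow_of_nonpos hy0 (by exact_mod_cast hyY) (by linarith [hs])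
  have hc : 0 ≤ B * (1 + ‖s‖ / s.re) := by
    have : 0 ≤ ‖s‖ / s.re := div_nonneg (norm_nonneg _) hs.le
    positivity
  calc ‖(∑ n ∈ Ioc 0 Y, χ n * (n : ℂ) ^ (-s)) - χ.LFunction s‖ +
        ‖(∑ n ∈ Ioc 0 y, χ n * (n : ℂ) ^ (-s)) - χ.LFunction s‖
      ≤ B * (1 + ‖s‖ / s.re) * (Y : ℝ) ^ (-s.re) + B * (1 + ‖s‖ / s.re) * (y : ℝ) ^ (-s.re) :=
        add_le_add hY hy'
    _ ≤ B * (1 + ‖s‖ / s.re) * (y : ℝ) ^ (-s.re) + B * (1 + ‖s‖ / s.re) * (y : ℝ) ^ (-s.re) := by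
        gcongr
    _ = 2 * B * (1 + ‖s‖ / s.re) * (y : ℝ) ^ (-s.re) := by ring


/-! ### Section D — elementary size bounds: `Σ_{m ≤ K} m^{-σ}` and `ζ(s)` ((3.9)) -/

/-- `Σ_{m ≤ K} 1/m ≤ 1 + log K` (Mathlib's `harmonic_le_one_add_log`). [folklore] -/
private theorem sum_Ioc_inv_le (K : ℕ) : ∑ m ∈ Ioc 0 K, ((m : ℝ))⁻¹ ≤ 1 + Real.log K := by
  have h := harmonic_le_one_add_log K
  have e : Ioc 0 K = Icc 1 K := rfl
  rw [e]
  simpa [harmonic_eq_sum_Icc, Rat.cast_sum, Rat.cast_inv, Rat.cast_natCast] using h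

/-- `Σ_{m ≤ K} m^{-σ} ≤ K^{1-σ}(1 + log K)` for `0 ≤ σ ≤ 1`. [folklore] -/
private theorem sum_Ioc_rpow_neg_le {σ : ℝ} (hσ1 : σ ≤ 1) (K : ℕ) :
    ∑ m ∈ Ioc 0 K, (m : ℝ) ^ (-σ) ≤ (K : ℝ) ^ (1 - σ) * (1 + Real.log K) := by
  calc ∑ m ∈ Ioc 0 K, (m : ℝ) ^ (-σ) = ∑ m ∈ Ioc 0 K, (m : ℝ) ^ (1 - σ) * ((m : ℝ))⁻¹ := by
        refine sum_congr rfl fun m hm => ?_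
        have hm0 : (0 : ℝ) < m := by exact_mod_cast (mem_Ioc.mp hm).1
        rw [← Real.rpow_neg_one, ← Real.rpow_add hm0]
        ring_nf
    _ ≤ ∑ m ∈ Ioc 0 K, (K : ℝ) ^ (1 - σ) * ((m : ℝ))⁻¹ := by
        refine sum_le_sum fun m hm => ?_
        have hm0 : (0 : ℝ) < m := by exact_mod_cast (mem_Ioc.mp hm).1
        have hmK : (m : ℝ) ≤ K := by exact_mod_cast (mem_Ioc.mp hm).2
        exact mul_le_mul_of_nonneg_right (Real.rpow_le_rpow hm0.le hmK (by linarith))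
          (inv_nonneg.mpr hm0.le)
    _ = (K : ℝ) ^ (1 - σ) * ∑ m ∈ Ioc 0 K, ((m : ℝ))⁻¹ := by rw [mul_sum]
    _ ≤ (K : ℝ) ^ (1 - σ) * (1 + Real.log K) :=
        mul_le_mul_of_nonneg_left (sum_Ioc_inv_le K) (by positivity)

/-- `‖Σ_{m ≤ K} m^{-s}‖ ≤ K^{1-σ}(1 + log K)` for `0 ≤ σ = Re s ≤ 1`. [folklore] -/
private theorem norm_sum_Ioc_cpow_le {s : ℂ} (hσ1 : s.re ≤ 1) (K : ℕ) :
    ‖∑ m ∈ Ioc 0 K, (m : ℂ) ^ (-s)‖ ≤ (K : ℝ) ^ (1 - s.re) * (1 + Real.log K) := by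
  refine (norm_sum_le _ _).trans ?_
  have e : ∑ m ∈ Ioc 0 K, ‖(m : ℂ) ^ (-s)‖ = ∑ m ∈ Ioc 0 K, (m : ℝ) ^ (-s.re) := by
    refine sum_congr rfl fun m hm => ?_
    rw [norm_natCast_cpow_of_pos (mem_Ioc.mp hm).1, neg_re]
  rw [e]
  exact sum_Ioc_rpow_neg_le hσ1 K

/-- **(3.9), explicit**: for `0 < σ = Re s ≤ 1`, `s ≠ 1`, with `M = ⌊‖s‖⌋ + 1`,
`‖ζ(s)‖ ≤ M^{1-σ} (1 + log M + 1/‖1 - s‖ + 1/σ)`.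
[cite: Pintz1976ElementaryIII, Lemma 4 proof (3.9) p. 299] -/
theorem norm_riemannZeta_le_floor {s : ℂ} (hs : 0 < s.re) (hσ1 : s.re ≤ 1) (hs1 : s ≠ 1) :
    ‖riemannZeta s‖ ≤ ((⌊‖s‖⌋₊ + 1 : ℕ) : ℝ) ^ (1 - s.re) *
      (1 + Real.log ((⌊‖s‖⌋₊ + 1 : ℕ) : ℝ) + 1 / ‖1 - s‖ + 1 / s.re) := by
  set M : ℕ := ⌊‖s‖⌋₊ + 1 with hM
  have hM1 : 1 ≤ M := by omega
  have hM0 : (0 : ℝ) < M := by exact_mod_cast hM1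
  have hsM : ‖s‖ ≤ (M : ℝ) := by
    rw [hM]; push_cast; exact (Nat.lt_floor_add_one ‖s‖).le
  have h1s : (1 - s) ≠ 0 := sub_ne_zero.mpr (Ne.symm hs1)
  have hid := sum_Icc_cpow_eq hs hs1 hM1
  have hz : riemannZeta s = (∑ m ∈ Icc 1 M, (m : ℂ) ^ (-s)) - (M : ℂ) ^ (1 - s) / (1 - s) -
      s * ∫ x in Set.Ioi (M : ℝ), ((Int.fract x : ℝ) : ℂ) * (x : ℂ) ^ (-(s + 1)) := by
    rw [hid]; ring
  rw [hz]
  have hIcc : Icc 1 M = Ioc 0 M := rfl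
  have t1 : ‖∑ m ∈ Icc 1 M, (m : ℂ) ^ (-s)‖ ≤ (M : ℝ) ^ (1 - s.re) * (1 + Real.log M) := by
    rw [hIcc]; exact norm_sum_Ioc_cpow_le hσ1 M
  have t2 : ‖(M : ℂ) ^ (1 - s) / (1 - s)‖ = (M : ℝ) ^ (1 - s.re) * (1 / ‖1 - s‖) := by
    rw [norm_div, norm_natCast_cpow_of_pos (by omega : 0 < M), sub_re, one_re]
    ring
  have t3 : ‖s * ∫ x in Set.Ioi (M : ℝ), ((Int.fract x : ℝ) : ℂ) * (x : ℂ) ^ (-(s + 1))‖ ≤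
      (M : ℝ) ^ (1 - s.re) * (1 / s.re) := by
    refine (norm_mul_integral_fract_le hs hM1).trans ?_
    have hpow : ‖s‖ * (M : ℝ) ^ (-s.re) ≤ (M : ℝ) ^ (1 - s.re) := by
      calc ‖s‖ * (M : ℝ) ^ (-s.re) ≤ (M : ℝ) * (M : ℝ) ^ (-s.re) :=
            mul_le_mul_of_nonneg_right hsM (by positivity)
        _ = (M : ℝ) ^ (1 - s.re) := by
            rw [show (1 - s.re) = 1 + (-s.re) by ring, Real.rpow_add hM0, Real.rpow_one]
    calc ‖s‖ * ((M : ℝ) ^ (-s.re) / s.re) = ‖s‖ * (M : ℝ) ^ (-s.re) * (1 / s.re) := by ring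
      _ ≤ (M : ℝ) ^ (1 - s.re) * (1 / s.re) :=
          mul_le_mul_of_nonneg_right hpow (by positivity)
  calc ‖(∑ m ∈ Icc 1 M, (m : ℂ) ^ (-s)) - (M : ℂ) ^ (1 - s) / (1 - s) -
        s * ∫ x in Set.Ioi (M : ℝ), ((Int.fract x : ℝ) : ℂ) * (x : ℂ) ^ (-(s + 1))‖
      ≤ ‖∑ m ∈ Icc 1 M, (m : ℂ) ^ (-s)‖ + ‖(M : ℂ) ^ (1 - s) / (1 - s)‖ +
          ‖s * ∫ x in Set.Ioi (M : ℝ), ((Int.fract x : ℝ) : ℂ) * (x : ℂ) ^ (-(s + 1))‖ :=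
        (norm_sub_le _ _).trans (add_le_add (norm_sub_le _ _) le_rfl)
    _ ≤ (M : ℝ) ^ (1 - s.re) * (1 + Real.log M) + (M : ℝ) ^ (1 - s.re) * (1 / ‖1 - s‖) +
          (M : ℝ) ^ (1 - s.re) * (1 / s.re) := by rw [t2]; exact add_le_add (add_le_add t1 le_rfl) t3
    _ = (M : ℝ) ^ (1 - s.re) * (1 + Real.log M + 1 / ‖1 - s‖ + 1 / s.re) := by ring


/-! ### Section E — the decomposition (3.3)–(3.4)/(3.7) as an exact identity -/

/-- `d^{-s} (x/d)^{1-s} = x^{1-s} d^{-1}` for real `x ≥ 0` and natural `d ≠ 0`. [folklore] -/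
private theorem cpow_neg_mul_div_cpow {x : ℝ} (hx : 0 ≤ x) {d : ℕ} (hd : d ≠ 0) (s : ℂ) :
    (d : ℂ) ^ (-s) * (((x / d : ℝ)) : ℂ) ^ (1 - s) = (x : ℂ) ^ (1 - s) * (d : ℂ) ^ (-(1 : ℂ)) := by
  have hd0 : (d : ℂ) ≠ 0 := by exact_mod_cast hd
  have hdinv : ((x / d : ℝ) : ℂ) = (x : ℂ) * (((d : ℝ)⁻¹ : ℝ) : ℂ) := by
    push_cast; ring
  rw [hdinv, mul_cpow_ofReal_nonneg hx (inv_nonneg.mpr (Nat.cast_nonneg d))]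
  have hinv : (((d : ℝ)⁻¹ : ℝ) : ℂ) ^ (1 - s) = (d : ℂ) ^ (s - 1) := by
    rw [ofReal_inv, ofReal_natCast, inv_cpow _ _ (by rw [natCast_arg]; exact Real.pi_ne_zero.symm),
      ← cpow_neg, neg_sub]
  rw [hinv, mul_left_comm, ← cpow_add _ _ hd0, show -s + (s - 1) = -(1 : ℂ) by ring]

/-- **The decomposition behind (3.8)** (exact identity). With `N = ⌊x⌋`, `1 ≤ z ≤ N`,
`U(K) = Σ_{m ≤ K} m^{-s}`, `V_w = Σ_{d ≤ z} χ(d) d^{-w}`, `R_d = U(⌊x/d⌋) − ζ(s) − (x/d)^{1-s}/(1-s)`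
and `W_m = Σ_{z < d ≤ N/m} χ(d) d^{-s}`:
`Σ_{n ≤ N} g(n) n^{-s} − L(s)ζ(s) − L(1) x^{1-s}/(1-s) = ζ(s)(V_s − L(s)) + (x^{1-s}/(1-s))(V_1 − L(1))
  + Σ_{d ≤ z} χ(d) d^{-s} R_d + Σ_{m ≤ N} m^{-s} W_m`.
[cite: Pintz1976ElementaryIII, Lemma 4 proof (3.3)–(3.8) pp. 298–299] -/
theorem lemma4_decomposition (s : ℂ) {x : ℝ} (hx : 0 ≤ x) {z : ℕ} (hzN : z ≤ ⌊x⌋₊) :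
    (∑ n ∈ Ioc 0 ⌊x⌋₊, (∑ d ∈ n.divisors, χ d) * (n : ℂ) ^ (-s)) -
        χ.LFunction s * riemannZeta s - χ.LFunction 1 * (x : ℂ) ^ (1 - s) / (1 - s) =
      riemannZeta s * ((∑ d ∈ Ioc 0 z, χ d * (d : ℂ) ^ (-s)) - χ.LFunction s) +
      (x : ℂ) ^ (1 - s) / (1 - s) * ((∑ d ∈ Ioc 0 z, χ d * (d : ℂ) ^ (-(1 : ℂ))) - χ.LFunction 1) +
      (∑ d ∈ Ioc 0 z, χ d * (d : ℂ) ^ (-s) *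
        ((∑ m ∈ Ioc 0 ⌊x / d⌋₊, (m : ℂ) ^ (-s)) - riemannZeta s -
          (((x / d : ℝ)) : ℂ) ^ (1 - s) / (1 - s))) +
      ∑ m ∈ Ioc 0 ⌊x⌋₊, (m : ℂ) ^ (-s) * ∑ d ∈ Ioc z (⌊x⌋₊ / m), χ d * (d : ℂ) ^ (-s) := by
  rw [sum_Ioc_divisorSum_mul_cpow_eq, ← sum_Ioc_consecutive _ (Nat.zero_le z) hzN,
    sum_Ioc_above_mul_sum_eq]
  -- the head `d ≤ z`
  have head : ∑ d ∈ Ioc 0 z, χ d * (d : ℂ) ^ (-s) * ∑ m ∈ Ioc 0 (⌊x⌋₊ / d), (m : ℂ) ^ (-s) =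
      ∑ d ∈ Ioc 0 z, (riemannZeta s * (χ d * (d : ℂ) ^ (-s)) +
        (x : ℂ) ^ (1 - s) / (1 - s) * (χ d * (d : ℂ) ^ (-(1 : ℂ))) +
        χ d * (d : ℂ) ^ (-s) *
          ((∑ m ∈ Ioc 0 ⌊x / d⌋₊, (m : ℂ) ^ (-s)) - riemannZeta s -
            (((x / d : ℝ)) : ℂ) ^ (1 - s) / (1 - s))) := by
    refine sum_congr rfl fun d hd => ?_
    have hd0 : d ≠ 0 := (mem_Ioc.mp hd).1.ne'
    rw [← Nat.floor_div_natCast x d]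
    have key := cpow_neg_mul_div_cpow hx hd0 s
    calc χ d * (d : ℂ) ^ (-s) * ∑ m ∈ Ioc 0 ⌊x / d⌋₊, (m : ℂ) ^ (-s)
        = riemannZeta s * (χ d * (d : ℂ) ^ (-s)) +
          χ d * ((d : ℂ) ^ (-s) * (((x / d : ℝ)) : ℂ) ^ (1 - s)) / (1 - s) +
          χ d * (d : ℂ) ^ (-s) *
            ((∑ m ∈ Ioc 0 ⌊x / d⌋₊, (m : ℂ) ^ (-s)) - riemannZeta s -
              (((x / d : ℝ)) : ℂ) ^ (1 - s) / (1 - s)) := by ring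
      _ = _ := by rw [key]; ring
  rw [head, sum_add_distrib, sum_add_distrib, ← mul_sum, ← mul_sum]
  ring


/-! ### Section F — norms of the four pieces of the decomposition -/

/-- `y/2 ≤ ⌊y⌋` for real `y ≥ 1`. [folklore] -/
private theorem half_le_floor {y : ℝ} (hy : 1 ≤ y) : y / 2 ≤ ((⌊y⌋₊ : ℕ) : ℝ) := by
  rcases le_or_gt 2 y with h2 | h2
  · have := Nat.lt_floor_add_one y
    linarith
  · have h1 : 1 ≤ ⌊y⌋₊ := Nat.le_floor (by exact_mod_cast hy)
    have : (1 : ℝ) ≤ ((⌊y⌋₊ : ℕ) : ℝ) := by exact_mod_cast h1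
    linarith

/-- `d^{-σ} ⌊x/d⌋^{-σ} ≤ 2 x^{-σ}` for `1 ≤ d ≤ x`, `0 ≤ σ ≤ 1`. [folklore] -/
private theorem rpow_neg_mul_floor_div_rpow_neg_le {σ : ℝ} (hσ0 : 0 ≤ σ) (hσ1 : σ ≤ 1) {x : ℝ} {d : ℕ}
    (hd : 1 ≤ d) (hdx : (d : ℝ) ≤ x) :
    (d : ℝ) ^ (-σ) * ((⌊x / d⌋₊ : ℕ) : ℝ) ^ (-σ) ≤ 2 * x ^ (-σ) := by
  have hd0 : (0 : ℝ) < d := by exact_mod_cast hd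
  have hx0 : 0 < x := hd0.trans_le hdx
  have hxd : 1 ≤ x / d := by rwa [le_div_iff₀ hd0, one_mul]
  have hfl : x / d / 2 ≤ ((⌊x / d⌋₊ : ℕ) : ℝ) := half_le_floor hxd
  have hprod : x / 2 ≤ (d : ℝ) * ((⌊x / d⌋₊ : ℕ) : ℝ) := by
    have : x / 2 = (d : ℝ) * (x / d / 2) := by field_simp
    rw [this]
    exact mul_le_mul_of_nonneg_left hfl hd0.le
  rw [← Real.mul_rpow hd0.le (Nat.cast_nonneg _)]
  calc ((d : ℝ) * ((⌊x / d⌋₊ : ℕ) : ℝ)) ^ (-σ) ≤ (x / 2) ^ (-σ) :=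
        Real.rpow_le_rpow_of_nonpos (by positivity) hprod (by linarith)
    _ = 2 ^ σ * x ^ (-σ) := by
        rw [Real.div_rpow hx0.le (by norm_num), Real.rpow_neg (by norm_num : (0:ℝ) ≤ 2)]
        field_simp
    _ ≤ 2 ^ (1 : ℝ) * x ^ (-σ) := by
        gcongr
        · norm_num
    _ = 2 * x ^ (-σ) := by rw [Real.rpow_one]

omit [NeZero q] in
/-- **Third piece**: `‖Σ_{d ≤ z} χ(d) d^{-s} R_d‖ ≤ 2 z (‖s‖/σ + 1) x^{-σ}` (`1 ≤ z ≤ x`,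
`0 < σ = Re s ≤ 1`, `s ≠ 1`). [cite: Pintz1976ElementaryIII, Lemma 4 proof (3.4) p. 299] -/
theorem norm_third_piece_le {s : ℂ} (hs : 0 < s.re) (hσ1 : s.re ≤ 1) (hs1 : s ≠ 1) {x : ℝ}
    {z : ℕ} (hzx : (z : ℝ) ≤ x) :
    ‖∑ d ∈ Ioc 0 z, χ d * (d : ℂ) ^ (-s) *
        ((∑ m ∈ Ioc 0 ⌊x / d⌋₊, (m : ℂ) ^ (-s)) - riemannZeta s -
          (((x / d : ℝ)) : ℂ) ^ (1 - s) / (1 - s))‖ ≤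
      2 * z * (‖s‖ / s.re + 1) * x ^ (-s.re) := by
  refine (norm_sum_le _ _).trans ?_
  have hterm : ∀ d ∈ Ioc 0 z, ‖χ d * (d : ℂ) ^ (-s) *
      ((∑ m ∈ Ioc 0 ⌊x / d⌋₊, (m : ℂ) ^ (-s)) - riemannZeta s -
        (((x / d : ℝ)) : ℂ) ^ (1 - s) / (1 - s))‖ ≤ 2 * (‖s‖ / s.re + 1) * x ^ (-s.re) := by
    intro d hd
    have hd1 : 1 ≤ d := (mem_Ioc.mp hd).1
    have hd0 : (0 : ℝ) < d := by exact_mod_cast hd1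
    have hdx : (d : ℝ) ≤ x := le_trans (by exact_mod_cast (mem_Ioc.mp hd).2) hzx
    have hxd : 1 ≤ x / d := by rwa [le_div_iff₀ hd0, one_mul]
    have hIoc : Ioc 0 ⌊x / d⌋₊ = Icc 1 ⌊x / d⌋₊ := rfl
    rw [norm_mul, norm_mul, norm_natCast_cpow_of_pos hd1, neg_re, hIoc]
    have hR := norm_sum_floor_cpow_sub_le hs hs1 hxd
    have hχd : ‖χ d‖ ≤ 1 := DirichletCharacter.norm_le_one χ _
    have hc : 0 ≤ ‖s‖ / s.re + 1 := by positivity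
    calc ‖χ (d : ZMod q)‖ * (d : ℝ) ^ (-s.re) *
          ‖(∑ m ∈ Icc 1 ⌊x / d⌋₊, (m : ℂ) ^ (-s)) - riemannZeta s -
            (((x / d : ℝ)) : ℂ) ^ (1 - s) / (1 - s)‖
        ≤ 1 * (d : ℝ) ^ (-s.re) * ((‖s‖ / s.re + 1) * ((⌊x / d⌋₊ : ℕ) : ℝ) ^ (-s.re)) := by
          gcongr
      _ = (‖s‖ / s.re + 1) * ((d : ℝ) ^ (-s.re) * ((⌊x / d⌋₊ : ℕ) : ℝ) ^ (-s.re)) := by ring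
      _ ≤ (‖s‖ / s.re + 1) * (2 * x ^ (-s.re)) :=
          mul_le_mul_of_nonneg_left (rpow_neg_mul_floor_div_rpow_neg_le hs.le hσ1 hd1 hdx) hc
      _ = 2 * (‖s‖ / s.re + 1) * x ^ (-s.re) := by ring
  calc ∑ d ∈ Ioc 0 z, ‖χ d * (d : ℂ) ^ (-s) *
        ((∑ m ∈ Ioc 0 ⌊x / d⌋₊, (m : ℂ) ^ (-s)) - riemannZeta s -
          (((x / d : ℝ)) : ℂ) ^ (1 - s) / (1 - s))‖
      ≤ ∑ d ∈ Ioc 0 z, 2 * (‖s‖ / s.re + 1) * x ^ (-s.re) := sum_le_sum hterm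
    _ = 2 * z * (‖s‖ / s.re + 1) * x ^ (-s.re) := by
        rw [sum_const, Nat.card_Ioc, Nat.sub_zero, nsmul_eq_mul]; ring

/-- **Fourth piece (Σ₂)**: with `N/z` the integer quotient,
`‖Σ_{m ≤ N} m^{-s} W_m‖ ≤ (N/z)^{1-σ}(1 + log(N/z)) · 2B(1 + ‖s‖/σ) z^{-σ}`
(`W_m = 0` once `m > N/z`). [cite: Pintz1976ElementaryIII, Lemma 4 proof (3.7) p. 299] -/
theorem norm_fourth_piece_le (hχ : χ ≠ 1) {B : ℝ} (hB : ∀ n, ‖partialSum χ n‖ ≤ B)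
    {s : ℂ} (hs : 0 < s.re) (hσ1 : s.re ≤ 1) {N z : ℕ} (hz : 1 ≤ z) :
    ‖∑ m ∈ Ioc 0 N, (m : ℂ) ^ (-s) * ∑ d ∈ Ioc z (N / m), χ d * (d : ℂ) ^ (-s)‖ ≤
      ((N / z : ℕ) : ℝ) ^ (1 - s.re) * (1 + Real.log ((N / z : ℕ) : ℝ)) *
        (2 * B * (1 + ‖s‖ / s.re) * (z : ℝ) ^ (-s.re)) := by
  have hB0 : 0 ≤ B := (norm_nonneg _).trans (hB 0)
  have hc : 0 ≤ 2 * B * (1 + ‖s‖ / s.re) * (z : ℝ) ^ (-s.re) := by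
    have : 0 ≤ ‖s‖ / s.re := div_nonneg (norm_nonneg _) hs.le
    positivity
  have hKN : N / z ≤ N := Nat.div_le_self N z
  -- the terms with `m > N/z` vanish
  have hvan : ∀ m ∈ Ioc (N / z) N, (m : ℂ) ^ (-s) * ∑ d ∈ Ioc z (N / m), χ d * (d : ℂ) ^ (-s) = 0 := by
    intro m hm
    have hm1 : N / z < m := (mem_Ioc.mp hm).1
    have hm0 : 0 < m := lt_of_le_of_lt (Nat.zero_le _) hm1
    have hNm : N < m * z := (Nat.div_lt_iff_lt_mul hz).mp hm1
    have hle : N / m ≤ z := by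
      rw [Nat.div_le_iff_le_mul_add_pred hm0]
      have : N < z * m := by rwa [mul_comm] at hNm
      omega
    rw [Finset.Ioc_eq_empty (not_lt.mpr hle), sum_empty, mul_zero]
  rw [← sum_Ioc_consecutive _ (Nat.zero_le (N / z)) hKN, sum_eq_zero hvan, add_zero]
  refine (norm_sum_le _ _).trans ?_
  have hW : ∀ m ∈ Ioc 0 (N / z),
      ‖(m : ℂ) ^ (-s) * ∑ d ∈ Ioc z (N / m), χ d * (d : ℂ) ^ (-s)‖ ≤
        (m : ℝ) ^ (-s.re) * (2 * B * (1 + ‖s‖ / s.re) * (z : ℝ) ^ (-s.re)) := by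
    intro m hm
    rw [norm_mul, norm_natCast_cpow_of_pos (mem_Ioc.mp hm).1, neg_re]
    refine mul_le_mul_of_nonneg_left ?_ (by positivity)
    rcases le_or_gt z (N / m) with hzY | hzY
    · exact norm_sum_Ioc_char_cpow_le χ hχ hB hs hz hzY
    · rw [Finset.Ioc_eq_empty (not_lt.mpr hzY.le), sum_empty, norm_zero]
      exact hc
  calc ∑ m ∈ Ioc 0 (N / z), ‖(m : ℂ) ^ (-s) * ∑ d ∈ Ioc z (N / m), χ d * (d : ℂ) ^ (-s)‖
      ≤ ∑ m ∈ Ioc 0 (N / z), (m : ℝ) ^ (-s.re) * (2 * B * (1 + ‖s‖ / s.re) * (z : ℝ) ^ (-s.re)) :=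
        sum_le_sum hW
    _ = (∑ m ∈ Ioc 0 (N / z), (m : ℝ) ^ (-s.re)) * (2 * B * (1 + ‖s‖ / s.re) * (z : ℝ) ^ (-s.re)) := by
        rw [sum_mul]
    _ ≤ ((N / z : ℕ) : ℝ) ^ (1 - s.re) * (1 + Real.log ((N / z : ℕ) : ℝ)) *
        (2 * B * (1 + ‖s‖ / s.re) * (z : ℝ) ^ (-s.re)) :=
        mul_le_mul_of_nonneg_right (sum_Ioc_rpow_neg_le hσ1 _) hc


/-! ### Section G — Pólya–Vinogradov input and the assembly -/

/-- The tree's Pólya–Vinogradov bound for every non-principal `χ` mod `q`, as a bound for the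
partial sums `S(n)`. [cite: MontgomeryVaughan2007, §9.4 Thm. 9.18] -/
theorem norm_partialSum_le_pv (hχ : χ ≠ 1) (n : ℕ) :
    ‖partialSum χ n‖ ≤ 4 / Real.pi ^ 2 * Real.sqrt q * Real.log q +
      8 / Real.pi ^ 2 * Real.sqrt q * Real.log (Real.log q) + 15 / 2 * Real.sqrt q := by
  rw [partialSum_eq_sum_Ioc, zero_add, show Ioc 0 n = Icc 1 n from rfl]
  exact Literature.NumberTheory.Sieve.LargeSieve.polyaVinogradov_of_ne_one_Icc hχ 1 n

omit [NeZero q] in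
/-- For `q ≥ 3`: the Pólya–Vinogradov constant is `≤ 9 √q log q`. [folklore] -/
private theorem pv_le_nine (hq : 3 ≤ q) :
    4 / Real.pi ^ 2 * Real.sqrt q * Real.log q +
      8 / Real.pi ^ 2 * Real.sqrt q * Real.log (Real.log q) + 15 / 2 * Real.sqrt q ≤
      9 * Real.sqrt q * Real.log q := by
  have hq3 : (3 : ℝ) ≤ q := by exact_mod_cast hq
  have hlog1 : 1 ≤ Real.log q := by
    rw [← Real.log_exp 1]
    exact Real.log_le_log (Real.exp_pos 1) (le_trans (le_of_lt (lt_trans Real.exp_one_lt_d9 (by norm_num))) hq3)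
  have hlog0 : 0 < Real.log q := by linarith
  have hll : Real.log (Real.log q) ≤ Real.log q := by
    have := Real.log_le_sub_one_of_pos hlog0
    linarith
  have hpi : 9 ≤ Real.pi ^ 2 := by nlinarith [Real.pi_gt_three]
  have hsq : 0 ≤ Real.sqrt q := Real.sqrt_nonneg _
  have h1 : 4 / Real.pi ^ 2 ≤ 4 / 9 := div_le_div_of_nonneg_left (by norm_num) (by norm_num) hpi
  have h2 : 8 / Real.pi ^ 2 ≤ 8 / 9 := div_le_div_of_nonneg_left (by norm_num) (by norm_num) hpi
  have e1 : 4 / Real.pi ^ 2 * Real.sqrt q * Real.log q ≤ 4 / 9 * Real.sqrt q * Real.log q := by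
    gcongr
  have e2 : 8 / Real.pi ^ 2 * Real.sqrt q * Real.log (Real.log q) ≤ 8 / 9 * Real.sqrt q * Real.log q := by
    calc 8 / Real.pi ^ 2 * Real.sqrt q * Real.log (Real.log q)
        ≤ 8 / Real.pi ^ 2 * Real.sqrt q * Real.log q :=
          mul_le_mul_of_nonneg_left hll (by positivity)
      _ ≤ 8 / 9 * Real.sqrt q * Real.log q := by gcongr
  have e3 : 15 / 2 * Real.sqrt q ≤ 15 / 2 * Real.sqrt q * Real.log q := by
    nlinarith
  nlinarith

/-- `⌊u⌋ + 1 ≤ 3u` and `⌊u⌋ + 1 ≤ 4u²` for `u ≥ 1/2`. [folklore] -/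
private theorem floor_add_one_le {u : ℝ} (hu : 1 / 2 ≤ u) :
    ((⌊u⌋₊ + 1 : ℕ) : ℝ) ≤ 3 * u ∧ ((⌊u⌋₊ + 1 : ℕ) : ℝ) ≤ 4 * u ^ 2 := by
  rcases lt_or_ge u 1 with h1 | h1
  · have : ⌊u⌋₊ = 0 := Nat.floor_eq_zero.mpr h1
    rw [this]; push_cast
    constructor <;> nlinarith
  · have hfl : ((⌊u⌋₊ : ℕ) : ℝ) ≤ u := Nat.floor_le (by linarith)
    push_cast
    constructor <;> nlinarith

set_option maxHeartbeats 800000 in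
/-- The bookkeeping of p. 300 (choice `z = √x·D^{1/4}·√A_s`, resp. `z = ⌊x⌋` when that exceeds `x`):
the four error terms of (3.8) are each `≪ x^τ|s|D^{1/4}√A_s log D log x/√x`; pure real
inequalities in the sizes `r = √x`, `t = D^{1/4}`, `a = √A_s`, `y = x^{1-σ}`, `nrm = |s|`.
[cite: Pintz1976ElementaryIII, Lemma 4 proof p. 300] -/
theorem lemma4_real_final {σ A B t a r x y Z M z nrm ℓ L : ℝ} (hy : 0 < y) (hyx : x ^ (1 - σ) = y)
    (hσh : 1 / 2 ≤ σ) (hσ1 : σ ≤ 1) (hA1 : 1 ≤ A) (ha1 : 1 ≤ a) (ha2 : a ^ 2 = A) (ht0 : 0 < t)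
    (hr0 : 0 < r) (hr2 : r ^ 2 = x) (hx1 : 1 ≤ x) (hℓ1 : 1 ≤ ℓ) (hL1 : 1 ≤ L) (hnrm : 1 / 2 ≤ nrm)
    (hsat : nrm * a * t ≤ r) (hB0 : 0 ≤ B) (hB9 : B ≤ 9 * t ^ 2 * L)
    (hM1 : 1 ≤ M) (hM3 : M ≤ 3 * nrm) (hM4 : M ≤ 4 * nrm ^ 2) (hZ : Z = r * t * a)
    (hz0 : 0 < z) (hzx : z ≤ x) (hzZ : z ≤ Z) (hcase : Z / 2 ≤ z ∨ (x / 2 ≤ z ∧ x ≤ Z)) :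
    M ^ (1 - σ) * (5 * A * ℓ) * (4 * B * nrm * z ^ (-σ)) +
      y * A * (2 * B * (1 / z)) +
      8 * nrm * z * y / x +
      16 * B * nrm * ℓ * y / z ≤
      2000 * (y * nrm * t * a * L * ℓ / r) := by
  -- common facts
  have hx0 : 0 < x := by linarith
  have ha0 : 0 < a := by linarith
  have hA0 : 0 < A := by linarith
  have hnrm0 : 0 < nrm := by linarith
  have hM0 : 0 < M := by linarith
  have hZ0 : 0 < Z := by rw [hZ]; positivity
  have hτ0 : 0 ≤ 1 - σ := by linarith
  have hτh : 1 - σ ≤ 1 / 2 := by linarith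
  set T : ℝ := y * nrm * t * a * L * ℓ / r with hT
  have hT0 : 0 ≤ T := by positivity
  have hconv : A * B ≤ 9 * t ^ 2 * a ^ 2 * L := by rw [ha2]; nlinarith
  have hnrmZ : nrm * Z ≤ x := by
    calc nrm * Z = (nrm * a * t) * r := by rw [hZ]; ring
      _ ≤ r * r := mul_le_mul_of_nonneg_right hsat hr0.le
      _ = x := by rw [← sq, hr2]
  have hzσ : z ^ (-σ) = z ^ (1 - σ) / z := by
    rw [show -σ = (1 - σ) - 1 by ring, Real.rpow_sub_one hz0.ne']
  have hsqrt3 : (3 : ℝ) ^ (1 - σ) ≤ 2 := by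
    calc (3 : ℝ) ^ (1 - σ) ≤ 3 ^ (1 / 2 : ℝ) :=
          Real.rpow_le_rpow_of_exponent_le (by norm_num) hτh
      _ = Real.sqrt 3 := by rw [Real.sqrt_eq_rpow]
      _ ≤ 2 := by
          rw [show (2 : ℝ) = Real.sqrt (2 ^ 2) by rw [Real.sqrt_sq (by norm_num)]]
          exact Real.sqrt_le_sqrt (by norm_num)
  have h2σ : (2 : ℝ) ^ σ ≤ 2 := by
    calc (2 : ℝ) ^ σ ≤ 2 ^ (1 : ℝ) := Real.rpow_le_rpow_of_exponent_le (by norm_num) hσ1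
      _ = 2 := Real.rpow_one 2
  have hLℓ : 1 ≤ L * ℓ := by nlinarith
  rcases hcase with hI | ⟨hII, hxZ⟩
  · -- Case I: `z ≥ Z/2`
    have hzinv : 1 / z ≤ 2 / Z := by
      rw [div_le_div_iff₀ hz0 hZ0]; linarith
    have hzpow : z ^ (-σ) ≤ 2 * Z ^ (1 - σ) / Z := by
      rw [hzσ]
      calc z ^ (1 - σ) / z = z ^ (1 - σ) * (1 / z) := by ring
        _ ≤ Z ^ (1 - σ) * (2 / Z) :=
            mul_le_mul (Real.rpow_le_rpow hz0.le hzZ hτ0) hzinv (by positivity) (by positivity)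
        _ = 2 * Z ^ (1 - σ) / Z := by ring
    have hMZ : (M * Z) ^ (1 - σ) ≤ 2 * y := by
      have hMZ3 : M * Z ≤ 3 * x := by nlinarith
      calc (M * Z) ^ (1 - σ) ≤ (3 * x) ^ (1 - σ) := Real.rpow_le_rpow (by positivity) hMZ3 hτ0
        _ = 3 ^ (1 - σ) * x ^ (1 - σ) := Real.mul_rpow (by norm_num) hx0.le
        _ = 3 ^ (1 - σ) * y := by rw [hyx]
        _ ≤ 2 * y := mul_le_mul_of_nonneg_right hsqrt3 hy.le
    have e1 : M ^ (1 - σ) * (5 * A * ℓ) * (4 * B * nrm * z ^ (-σ)) ≤ 720 * T := by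
      calc M ^ (1 - σ) * (5 * A * ℓ) * (4 * B * nrm * z ^ (-σ))
          ≤ M ^ (1 - σ) * (5 * A * ℓ) * (4 * B * nrm * (2 * Z ^ (1 - σ) / Z)) := by gcongr
        _ = 40 * ℓ * nrm * (A * B) * (M ^ (1 - σ) * Z ^ (1 - σ)) / Z := by ring
        _ = 40 * ℓ * nrm * (A * B) * (M * Z) ^ (1 - σ) / Z := by
            rw [Real.mul_rpow hM0.le hZ0.le]
        _ ≤ 40 * ℓ * nrm * (9 * t ^ 2 * a ^ 2 * L) * (2 * y) / Z := by gcongr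
        _ = 720 * T := by rw [hT, hZ]; field_simp; ring
    have e2 : y * A * (2 * B * (1 / z)) ≤ 144 * T := by
      calc y * A * (2 * B * (1 / z)) ≤ y * A * (2 * B * (2 / Z)) := by gcongr
        _ = 4 * y * (A * B) / Z := by ring
        _ ≤ 4 * y * (9 * t ^ 2 * a ^ 2 * L) / Z := by gcongr
        _ = 36 * (y * t * a * L / r) := by rw [hZ]; field_simp; ring
        _ ≤ 36 * (y * t * a * L / r * (4 * (nrm * ℓ))) := by
            refine mul_le_mul_of_nonneg_left ?_ (by norm_num)
            have h4 : 1 ≤ 4 * (nrm * ℓ) := by nlinarith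
            exact le_mul_of_one_le_right (by positivity) h4
        _ = 144 * T := by rw [hT]; ring
    have e3 : 8 * nrm * z * y / x ≤ 8 * T := by
      calc 8 * nrm * z * y / x ≤ 8 * nrm * Z * y / x := by gcongr
        _ = 8 * (y * nrm * t * a / r) := by
            rw [hZ, ← hr2]; field_simp
        _ ≤ 8 * (y * nrm * t * a / r * (L * ℓ)) := by
            refine mul_le_mul_of_nonneg_left ?_ (by norm_num)
            exact le_mul_of_one_le_right (by positivity) hLℓ
        _ = 8 * T := by rw [hT]; ring
    have e4 : 16 * B * nrm * ℓ * y / z ≤ 288 * T := by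
      have ha21 : 1 ≤ a ^ 2 := by nlinarith
      have hfrac : t ^ 2 * (2 / Z) ≤ 2 * (t * a / r) := by
        rw [hZ, div_eq_mul_inv, div_eq_mul_inv]
        have hrt : 0 < r * t * a := by positivity
        rw [show t ^ 2 * (2 * (r * t * a)⁻¹) = 2 * (t / (r * a)) by field_simp]
        rw [show 2 * (t * a * r⁻¹) = 2 * (t * a / r) by ring]
        gcongr 2 * ?_
        rw [div_le_div_iff₀ (by positivity) hr0]
        nlinarith [mul_nonneg (mul_nonneg ht0.le hr0.le) (sub_nonneg.mpr ha21)]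
      calc 16 * B * nrm * ℓ * y / z = 16 * B * nrm * ℓ * y * (1 / z) := by ring
        _ ≤ 16 * (9 * t ^ 2 * L) * nrm * ℓ * y * (2 / Z) := by gcongr
        _ = 144 * (y * nrm * L * ℓ) * (t ^ 2 * (2 / Z)) := by ring
        _ ≤ 144 * (y * nrm * L * ℓ) * (2 * (t * a / r)) :=
            mul_le_mul_of_nonneg_left hfrac (by positivity)
        _ = 288 * T := by rw [hT]; ring
    linarith
  · -- Case II: `z ≥ x/2`, `x ≤ Z`
    have hzinv : 1 / z ≤ 2 / x := by
      rw [div_le_div_iff₀ hz0 hx0]; linarith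
    have hzpow : z ^ (-σ) ≤ 2 * y / x := by
      calc z ^ (-σ) ≤ (x / 2) ^ (-σ) := Real.rpow_le_rpow_of_nonpos (by positivity) hII (by linarith)
        _ = 2 ^ σ * x ^ (-σ) := by
            rw [Real.div_rpow hx0.le (by norm_num), Real.rpow_neg (by norm_num : (0:ℝ) ≤ 2)]
            field_simp
        _ ≤ 2 * x ^ (-σ) := mul_le_mul_of_nonneg_right h2σ (Real.rpow_nonneg hx0.le _)
        _ = 2 * y / x := by
            rw [show -σ = (1 - σ) - 1 by ring, Real.rpow_sub_one hx0.ne', hyx]; ring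
    have hMpow : M ^ (1 - σ) ≤ 2 * nrm := by
      calc M ^ (1 - σ) ≤ M ^ (1 / 2 : ℝ) := Real.rpow_le_rpow_of_exponent_le hM1 hτh
        _ = Real.sqrt M := by rw [Real.sqrt_eq_rpow]
        _ ≤ Real.sqrt ((2 * nrm) ^ 2) := Real.sqrt_le_sqrt (by nlinarith)
        _ = 2 * nrm := Real.sqrt_sq (by linarith)
    have hta : r ≤ t * a := by
      have : r * r ≤ r * (t * a) := by rw [← sq, hr2]; calc x ≤ Z := hxZ
        _ = r * (t * a) := by rw [hZ]; ring
      exact le_of_mul_le_mul_left this hr0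
    have e1 : M ^ (1 - σ) * (5 * A * ℓ) * (4 * B * nrm * z ^ (-σ)) ≤ 720 * T := by
      calc M ^ (1 - σ) * (5 * A * ℓ) * (4 * B * nrm * z ^ (-σ))
          ≤ (2 * nrm) * (5 * A * ℓ) * (4 * B * nrm * (2 * y / x)) := by gcongr
        _ = 80 * ℓ * nrm * y * ((A * B) * nrm) / x := by ring
        _ ≤ 80 * ℓ * nrm * y * (9 * t * a * L * r) / x := by
            have hk : A * B * nrm ≤ 9 * t * a * L * r :=
              calc A * B * nrm ≤ 9 * t ^ 2 * a ^ 2 * L * nrm := by nlinarith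
                _ = 9 * t * a * L * (nrm * a * t) := by ring
                _ ≤ 9 * t * a * L * r := mul_le_mul_of_nonneg_left hsat (by positivity)
            gcongr 80 * ℓ * nrm * y * ?_ / x
        _ = 720 * T := by rw [hT, ← hr2]; field_simp; ring
    have e2 : y * A * (2 * B * (1 / z)) ≤ 144 * T := by
      have hkey : A * B ≤ 36 * t * a * L * nrm * r := by
        have hk2 : t * a ≤ 4 * nrm * r := by
          nlinarith [mul_le_mul_of_nonneg_left hsat (by positivity : (0:ℝ) ≤ 4 * nrm),
            mul_nonneg (mul_nonneg ht0.le ha0.le) (by nlinarith : (0:ℝ) ≤ 4 * nrm ^ 2 - 1)]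
        calc A * B ≤ 9 * t ^ 2 * a ^ 2 * L := hconv
          _ = 9 * t * a * L * (t * a) := by ring
          _ ≤ 9 * t * a * L * (4 * nrm * r) := mul_le_mul_of_nonneg_left hk2 (by positivity)
          _ = 36 * t * a * L * nrm * r := by ring
      calc y * A * (2 * B * (1 / z)) ≤ y * A * (2 * B * (2 / x)) := by gcongr
        _ = 4 * y * (A * B) / x := by ring
        _ ≤ 4 * y * (36 * t * a * L * nrm * r) / x := by gcongr
        _ = 144 * (y * nrm * t * a * L / r) := by rw [← hr2]; field_simp; ring
        _ ≤ 144 * (y * nrm * t * a * L / r * ℓ) := by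
            refine mul_le_mul_of_nonneg_left ?_ (by norm_num)
            exact le_mul_of_one_le_right (by positivity) hℓ1
        _ = 144 * T := by rw [hT]; ring
    have e3 : 8 * nrm * z * y / x ≤ 8 * T := by
      calc 8 * nrm * z * y / x ≤ 8 * nrm * x * y / x := by gcongr
        _ = 8 * nrm * y := by field_simp
        _ = 8 * (y * nrm * (r / r)) := by rw [div_self hr0.ne']; ring
        _ ≤ 8 * (y * nrm * (t * a * (L * ℓ) / r)) := by
            gcongr
            calc r = r * 1 := (mul_one r).symm
              _ ≤ (t * a) * (L * ℓ) := mul_le_mul hta hLℓ (by norm_num) (by positivity)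
        _ = 8 * T := by rw [hT]; ring
    have e4 : 16 * B * nrm * ℓ * y / z ≤ 576 * T := by
      have htr : t ≤ 2 * a * r := by nlinarith
      calc 16 * B * nrm * ℓ * y / z = 16 * B * nrm * ℓ * y * (1 / z) := by ring
        _ ≤ 16 * (9 * t ^ 2 * L) * nrm * ℓ * y * (2 / x) := by gcongr
        _ = 288 * (y * nrm * L * ℓ / r) * (t * (t / r)) := by
            rw [← hr2]; field_simp; ring
        _ ≤ 288 * (y * nrm * L * ℓ / r) * (t * (2 * a)) := by
            gcongr
            rw [div_le_iff₀ hr0]; linarith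
        _ = 576 * T := by rw [hT]; ring
    linarith

set_option maxHeartbeats 800000 in
/-- **Pintz 1976 (III), Lemma 4 — PROVED in its repaired form** (`C = 2000`, `D₁ = 200`).
[cite: Pintz1976ElementaryIII, Lemma 4 p. 298 (3.1)–(3.2), proof pp. 298–300] -/
theorem _root_.Literature.NumberTheory.LFunctions.pintz1976Deuring_lemma4_largeD_holds :
    pintz1976Deuring_lemma4_largeD := by
  refine ⟨2000, 200, ?_⟩
  intro D _ hD χ hχ s hs1 hτ0 hτ1 x hx
  -- the parameters `σ, A` and their ranges
  set σ : ℝ := s.re with hσdef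
  have hσ1 : σ ≤ 1 := by linarith
  have hσh : 1 / 2 ≤ σ := by linarith
  have hσ0 : 0 < σ := by linarith
  set A : ℝ := max 1 (1 / ‖1 - s‖) with hAdef
  have hA1 : 1 ≤ A := le_max_left _ _
  have hA0 : 0 < A := by linarith
  have hAinv : 1 / ‖1 - s‖ ≤ A := le_max_right _ _
  have hsn : 1 / 2 ≤ ‖s‖ :=
    le_trans (by rw [abs_of_nonneg (by linarith)]; linarith) (abs_re_le_norm s)
  have hs0 : 0 < ‖s‖ := by linarith
  -- `D`, `t = D^{1/4}`
  have hD3 : 3 ≤ D := by omega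
  have hDr : (200 : ℝ) ≤ D := by exact_mod_cast hD.le
  have hD0 : (0 : ℝ) < D := by linarith
  have hL1 : 1 ≤ Real.log D := by
    rw [← Real.log_exp 1]
    exact Real.log_le_log (Real.exp_pos 1) (by linarith [Real.exp_one_lt_d9])
  set t : ℝ := (D : ℝ) ^ (1 / 4 : ℝ) with htdef
  have ht0 : 0 < t := Real.rpow_pos_of_pos hD0 _
  have ht2 : t ^ 2 = Real.sqrt D := by
    rw [htdef, ← Real.rpow_natCast, ← Real.rpow_mul hD0.le, Real.sqrt_eq_rpow]; norm_num
  have hsqrtD : 14 ≤ Real.sqrt D := by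
    rw [show (14 : ℝ) = Real.sqrt (14 ^ 2) by rw [Real.sqrt_sq (by norm_num)]]
    exact Real.sqrt_le_sqrt (by linarith)
  -- `A`, `a = √A`
  set a : ℝ := Real.sqrt A with hadef
  have ha1 : 1 ≤ a := by rw [hadef, ← Real.sqrt_one]; exact Real.sqrt_le_sqrt hA1
  have ha0 : 0 < a := by linarith
  have ha2 : a ^ 2 = A := Real.sq_sqrt hA0.le
  -- `x`, `r = √x`
  have hx14 : 14 * ‖s‖ ^ 2 ≤ x := by
    have h1 : ‖s‖ ^ 2 * 1 * 14 ≤ ‖s‖ ^ 2 * A * Real.sqrt D := by gcongr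
    calc 14 * ‖s‖ ^ 2 = ‖s‖ ^ 2 * 1 * 14 := by ring
      _ ≤ ‖s‖ ^ 2 * A * Real.sqrt D := h1
      _ ≤ x := hx
  have hx35 : (7 / 2 : ℝ) ≤ x := by nlinarith
  have hx1 : 1 ≤ x := by linarith
  have hx0 : 0 < x := by linarith
  have hℓ1 : 1 ≤ Real.log x := by
    rw [← Real.log_exp 1]
    exact Real.log_le_log (Real.exp_pos 1) (by linarith [Real.exp_one_lt_d9])
  set r : ℝ := Real.sqrt x with hrdef
  have hr0 : 0 < r := Real.sqrt_pos.mpr hx0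
  have hr2 : r ^ 2 = x := Real.sq_sqrt hx0.le
  -- the hypothesis `‖s‖² A √D ≤ x` as `‖s‖ a t ≤ r`
  have hsat : ‖s‖ * a * t ≤ r := by
    have h2 : (‖s‖ * a * t) ^ 2 ≤ r ^ 2 := by
      calc (‖s‖ * a * t) ^ 2 = ‖s‖ ^ 2 * a ^ 2 * t ^ 2 := by ring
        _ = ‖s‖ ^ 2 * A * Real.sqrt D := by rw [ha2, ht2]
        _ ≤ x := hx
        _ = r ^ 2 := hr2.symm
    exact (abs_le_of_sq_le_sq' h2 hr0.le).2
  -- `N = ⌊x⌋`, the Pólya–Vinogradov bound `B`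
  set N : ℕ := ⌊x⌋₊ with hNdef
  have hN1 : 1 ≤ N := Nat.le_floor (by exact_mod_cast hx1)
  have hNx : (N : ℝ) ≤ x := Nat.floor_le hx0.le
  set B : ℝ := 4 / Real.pi ^ 2 * Real.sqrt D * Real.log D +
      8 / Real.pi ^ 2 * Real.sqrt D * Real.log (Real.log D) + 15 / 2 * Real.sqrt D with hBdef
  have hB : ∀ n, ‖partialSum χ n‖ ≤ B := norm_partialSum_le_pv χ hχ
  have hB0 : 0 ≤ B := (norm_nonneg _).trans (hB 0)
  have hB9 : B ≤ 9 * t ^ 2 * Real.log D := by rw [ht2]; exact pv_le_nine hD3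
  -- `M = ⌊‖s‖⌋ + 1` and the bound for `ζ(s)`
  set M : ℕ := ⌊‖s‖⌋₊ + 1 with hMdef
  have hM1 : (1 : ℝ) ≤ M := by rw [hMdef]; push_cast; linarith [Nat.cast_nonneg (α := ℝ) ⌊‖s‖⌋₊]
  have hM0 : (0 : ℝ) < M := by linarith
  obtain ⟨hM3, hM4⟩ := floor_add_one_le hsn
  have hMx : (M : ℝ) ≤ x := by linarith
  have hlogM : Real.log M ≤ Real.log x := Real.log_le_log hM0 hMx
  have hζ : ‖riemannZeta s‖ ≤ (M : ℝ) ^ (1 - σ) * (5 * A * Real.log x) := by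
    refine (norm_riemannZeta_le_floor hσ0 hσ1 hs1).trans ?_
    refine mul_le_mul_of_nonneg_left ?_ (by positivity)
    have h2 : 1 / σ ≤ 2 := by rw [div_le_iff₀ hσ0]; linarith
    have hAℓ : 1 ≤ A * Real.log x := by nlinarith
    have hℓA : Real.log x ≤ A * Real.log x := by nlinarith
    have hAA : A ≤ A * Real.log x := by nlinarith
    linarith
  -- `Z = r t a` and the splitting point `z = min ⌊x⌋ ⌊Z⌋`
  set Z : ℝ := r * t * a with hZdef
  have hZ0 : 0 < Z := by positivity
  have hZ1 : 1 ≤ Z := by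
    have hr1 : 1 ≤ r := by rw [hrdef, ← Real.sqrt_one]; exact Real.sqrt_le_sqrt hx1
    have ht1 : 1 ≤ t := by rw [htdef]; exact Real.one_le_rpow (by linarith) (by norm_num)
    calc (1 : ℝ) = 1 * 1 * 1 := by ring
      _ ≤ r * t * a := by gcongr
  set z : ℕ := min N ⌊Z⌋₊ with hzdef
  have hzN : z ≤ N := min_le_left _ _
  have hzZ' : z ≤ ⌊Z⌋₊ := min_le_right _ _
  have hz1 : 1 ≤ z := le_min hN1 (Nat.le_floor (by exact_mod_cast hZ1))
  have hz0 : (0 : ℝ) < z := by exact_mod_cast hz1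
  have hzx : (z : ℝ) ≤ x := le_trans (by exact_mod_cast hzN) hNx
  have hzZ : (z : ℝ) ≤ Z := le_trans (by exact_mod_cast hzZ') (Nat.floor_le hZ0.le)
  have hcase : Z / 2 ≤ z ∨ (x / 2 ≤ z ∧ x ≤ Z) := by
    rcases le_or_gt ⌊Z⌋₊ N with h | h
    · left
      have : z = ⌊Z⌋₊ := min_eq_right h
      rw [this]; exact half_le_floor hZ1
    · right
      have hzN' : z = N := min_eq_left h.le
      refine ⟨by rw [hzN']; exact half_le_floor hx1, ?_⟩
      have h1 : (N : ℝ) + 1 ≤ ((⌊Z⌋₊ : ℕ) : ℝ) := by exact_mod_cast h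
      have h2 : x < (N : ℝ) + 1 := Nat.lt_floor_add_one x
      linarith [Nat.floor_le hZ0.le]
  -- exponent bookkeeping
  have hxσ : x ^ (-σ) = x ^ (1 - σ) / x := by
    rw [show -σ = (1 - σ) - 1 by ring, Real.rpow_sub_one hx0.ne']
  have hzσ : (z : ℝ) ^ (-σ) = (z : ℝ) ^ (1 - σ) / z := by
    rw [show -σ = (1 - σ) - 1 by ring, Real.rpow_sub_one hz0.ne']
  have hxτ0 : 0 < x ^ (1 - σ) := Real.rpow_pos_of_pos hx0 _
  have h4s : 1 + ‖s‖ / σ ≤ 4 * ‖s‖ := by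
    have : ‖s‖ / σ ≤ 2 * ‖s‖ := by rw [div_le_iff₀ hσ0]; nlinarith
    linarith
  have h4s' : ‖s‖ / σ + 1 ≤ 4 * ‖s‖ := by linarith
  -- the target quantity
  set T : ℝ := x ^ (1 - σ) * ‖s‖ * t * a * Real.log D * Real.log x / r with hTdef
  have hIcc : Icc 1 ⌊x⌋₊ = Ioc 0 ⌊x⌋₊ := rfl
  rw [hIcc, lemma4_decomposition χ s hx0.le hzN]
  -- the four pieces
  have P1 : ‖riemannZeta s * ((∑ d ∈ Ioc 0 z, χ d * (d : ℂ) ^ (-s)) - χ.LFunction s)‖ ≤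
      (M : ℝ) ^ (1 - σ) * (5 * A * Real.log x) * (4 * B * ‖s‖ * (z : ℝ) ^ (-σ)) := by
    rw [norm_mul]
    refine mul_le_mul hζ ?_ (norm_nonneg _) (by positivity)
    refine (norm_sum_char_cpow_sub_LFunction_le χ hχ hB hσ0 hz1).trans ?_
    have : B * (1 + ‖s‖ / σ) ≤ 4 * B * ‖s‖ := by nlinarith
    exact mul_le_mul_of_nonneg_right this (by positivity)
  have P2 : ‖(x : ℂ) ^ (1 - s) / (1 - s) *
      ((∑ d ∈ Ioc 0 z, χ d * (d : ℂ) ^ (-(1 : ℂ))) - χ.LFunction 1)‖ ≤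
      x ^ (1 - σ) * A * (2 * B * (1 / (z : ℝ))) := by
    rw [norm_mul, norm_div, norm_cpow_eq_rpow_re_of_pos hx0, sub_re, one_re]
    refine mul_le_mul ?_ ?_ (norm_nonneg _) (by positivity)
    · rw [div_eq_mul_one_div]
      exact mul_le_mul_of_nonneg_left hAinv hxτ0.le
    · have h := norm_sum_char_cpow_sub_LFunction_le χ hχ hB (s := 1) (by simp) hz1
      simp only [one_re, norm_one, div_one] at h
      refine h.trans (le_of_eq ?_)
      rw [Real.rpow_neg_one]
      ring
  have P3 : ‖∑ d ∈ Ioc 0 z, χ d * (d : ℂ) ^ (-s) *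
        ((∑ m ∈ Ioc 0 ⌊x / d⌋₊, (m : ℂ) ^ (-s)) - riemannZeta s -
          (((x / d : ℝ)) : ℂ) ^ (1 - s) / (1 - s))‖ ≤ 8 * ‖s‖ * z * x ^ (1 - σ) / x := by
    refine (norm_third_piece_le χ hσ0 hσ1 hs1 hzx).trans ?_
    rw [← hσdef, hxσ]
    have : 2 * (z : ℝ) * (‖s‖ / σ + 1) ≤ 2 * z * (4 * ‖s‖) :=
      mul_le_mul_of_nonneg_left h4s' (by positivity)
    calc 2 * (z : ℝ) * (‖s‖ / σ + 1) * (x ^ (1 - σ) / x)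
        ≤ 2 * z * (4 * ‖s‖) * (x ^ (1 - σ) / x) := mul_le_mul_of_nonneg_right this (by positivity)
      _ = 8 * ‖s‖ * z * x ^ (1 - σ) / x := by ring
  have hK : ((N / z : ℕ) : ℝ) ≤ x / z := by
    rw [le_div_iff₀ hz0]
    calc ((N / z : ℕ) : ℝ) * z = ((N / z * z : ℕ) : ℝ) := by push_cast; ring
      _ ≤ N := by exact_mod_cast Nat.div_mul_le_self N z
      _ ≤ x := hNx
  have hlogK0 : 0 ≤ 1 + Real.log ((N / z : ℕ) : ℝ) := by
    rcases Nat.eq_zero_or_pos (N / z) with h0 | hpos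
    · rw [h0]; simp
    · have : (1 : ℝ) ≤ ((N / z : ℕ) : ℝ) := by exact_mod_cast hpos
      linarith [Real.log_nonneg this]
  have hKlog : 1 + Real.log ((N / z : ℕ) : ℝ) ≤ 2 * Real.log x := by
    rcases Nat.eq_zero_or_pos (N / z) with h0 | hpos
    · rw [h0]; simp; linarith
    · have hK0 : (0 : ℝ) < ((N / z : ℕ) : ℝ) := by exact_mod_cast hpos
      have : Real.log ((N / z : ℕ) : ℝ) ≤ Real.log x :=
        Real.log_le_log hK0 (hK.trans (div_le_self hx0.le (by exact_mod_cast hz1)))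
      linarith
  have hKpow : ((N / z : ℕ) : ℝ) ^ (1 - σ) * (z : ℝ) ^ (-σ) ≤ x ^ (1 - σ) / z := by
    calc ((N / z : ℕ) : ℝ) ^ (1 - σ) * (z : ℝ) ^ (-σ) ≤ (x / z) ^ (1 - σ) * (z : ℝ) ^ (-σ) := by
          gcongr
      _ = x ^ (1 - σ) / z := by
          rw [Real.div_rpow hx0.le hz0.le, hzσ]
          field_simp
  have P4 : ‖∑ m ∈ Ioc 0 ⌊x⌋₊, (m : ℂ) ^ (-s) * ∑ d ∈ Ioc z (⌊x⌋₊ / m), χ d * (d : ℂ) ^ (-s)‖ ≤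
      16 * B * ‖s‖ * Real.log x * x ^ (1 - σ) / z := by
    refine (norm_fourth_piece_le χ hχ hB hσ0 hσ1 (N := N) hz1).trans ?_
    rw [← hσdef]
    have e : ((N / z : ℕ) : ℝ) ^ (1 - σ) * (1 + Real.log ((N / z : ℕ) : ℝ)) *
        (2 * B * (1 + ‖s‖ / σ) * (z : ℝ) ^ (-σ)) =
        (((N / z : ℕ) : ℝ) ^ (1 - σ) * (z : ℝ) ^ (-σ)) * (1 + Real.log ((N / z : ℕ) : ℝ)) *
          (2 * B * (1 + ‖s‖ / σ)) := by ring
    rw [e]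
    calc (((N / z : ℕ) : ℝ) ^ (1 - σ) * (z : ℝ) ^ (-σ)) * (1 + Real.log ((N / z : ℕ) : ℝ)) *
          (2 * B * (1 + ‖s‖ / σ))
        ≤ (x ^ (1 - σ) / z) * (2 * Real.log x) * (2 * B * (4 * ‖s‖)) := by gcongr
      _ = 16 * B * ‖s‖ * Real.log x * x ^ (1 - σ) / z := by ring
  -- assembly
  refine le_trans (norm_add_le _ _) ?_
  refine le_trans (add_le_add (norm_add_le _ _) le_rfl) ?_
  refine le_trans (add_le_add (add_le_add (norm_add_le _ _) le_rfl) le_rfl) ?_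
  refine le_trans (add_le_add (add_le_add (add_le_add P1 P2) P3) P4) ?_
  exact lemma4_real_final hxτ0 rfl hσh hσ1 hA1 ha1 ha2 ht0 hr0 hr2 hx1 hℓ1 hL1 hsn hsat hB0 hB9
    hM1 hM3 hM4 rfl hz0 hzx hzZ hcase

end Pintz1976Deuring

end Literature.NumberTheory.LFunctions

end
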